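import Summits.QuantumFields.YangMills.Theorems.BalabanUVNodesK2CornerRoadSign

/-!
# Crux K2⁷ `EndpointGivenBR13SepCoPH` (stmt-QuantumFields-20543) — plan g84's CORNER RE-KEY (v7c) ON K3⁷'s LETTERS (hypothesis form; 0 `def`, 0 `sorry`): the joint stub
# 2ᶜᴰ «the corner limits of the β of record exist and DRIFT with a POSITIVE slope» together with K3⁷'s U3 letters ALREADY concludes the crux decl BY NAME (no 1ᶜᴿ on this road),
# and on those letters 2ᶜᴰ IS the κ-free SIGN BIT of the corner road

Cell `ym-nodeO-ideate`, PROVER seat `ym-nodeO-port-1` (gen 2).  Fourth file of the corner road after `BalabanUVNodesK2CornerRoad` (p599976), `BalabanUVNodesK2NamedJetsLimit` (p607079,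
seat d1-w1) and `BalabanUVNodesK2CornerRoadSign` (p609637).  Helper for crux K2⁷ = stmt-QuantumFields-20543 (`--supports … --as helper`); count-neutral; NO skeleton is registered
by this file; the v7 cut is the plan's (plan g84 `[YMPLAN-G84-K2V7-WINDOW-OUTCOME + CORNER RE-KEY DRAFT 39189bf31904f7f3]`: 2ᶜᴰ `CornerDriftPos` := crux prefix →
`∃ (b : ℕ → ℝ) (s A : ℝ), ScaleAnchor D.βfun b ∧ 0 < s ∧ OneLoopDrift s A b`; 1ᶜᴿ `RunChain190AtCornerDriftSlope` = an4's (190)-chain rows at the anchored `b`).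
ATTRIBUTION.  The levers are p599976 §1 (this seat g0, idea-7's corner mathematics): N17 + anchor ⟹ geometric convergence (`tendsto_of_scaleShiftRate_scaleAnchor`), the Cesàro
junction (`eventually_ge_of_scaleAnchor_drift`), «geometric convergence IS a drift at the limit slope» (`oneLoopDrift_of_geometric`) and the sign road's END
(`endpointExistence_of_letters_scaleAnchor_eventuallyPos`); p609637 §4 (the κ-free cut; `exists_scaleAnchor_of_histLipschitz`); dag-n17-w1 g4's N17-keyed twin
`…N17RunWindowShiftCornerDrift` consumes the same 2ᶜᴰ text through node N17's own letter + one-level (C) (a different keying; nothing of it restated here).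

CONTENTS (texts INLINE at the crux's keying `(unity ∧ slots) → Admissible → (B) → K2V6Defs.Window13 F θ hP`; U3ᴷ = p599976 §3's K3⁷-shared triple; 2ᶜᴰ-text = v7c's body VERBATIM (draft
39189bf3 :535 = edition e44bc6edd44424e5 :540); SomeCornerPosᴷ ∕ CornerSignᴷ = p609637's texts):
* ★★★ `EndpointGivenBR13SepCoPH_of_u3K_cornerDriftPosK` — U3ᴷ → 2ᶜᴰ-text → `…Theses.BalabanUVNodes.EndpointGivenBR13SepCoPH` BY NAME: a LINE 2 := {`stub_u3Triple13K`, v7c's OWN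
  `stub_cornerDriftPos13`} closes by ONE `exact`, sharing the registered 2ᶜᴰ stub verbatim.
* `someCornerPosK_of_u3K_cornerDriftPosK` (drift ⟹ sign, via Cesàro under N17) · ★ `cornerDriftPosK_of_u3K_someCornerPosK` (sign ⟹ drift: N17 makes the anchoring sequence converge
  geometrically to a limit `≥ e > 0`, which IS a two-sided drift at that slope) · ★★ `cornerDriftPosK_iff_someCornerPosK_of_u3K` (GIVEN U3ᴷ: v7c's 2ᶜᴰ ⟺ the κ-free sign bit
  — beyond the EXISTENCE of the corner limits, which U3 supplies (`exists_scaleAnchor_of_histLipschitz`), the joint stub carries exactly ONE BIT on K3⁷'s letters).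
* `cornerDriftPosK_of_u3K_cornerSignK` — the ∀-form κ-free sign text (p609637 LINE 2⁰) feeds v7c's 2ᶜᴰ on K3⁷'s letters.  (The κ-NAMED suppliers of 2ᶜᴰ are the d1 desks': d1-w1 g2
  `…K2CornerDriftOfAnchorSign.cornerDriftText_of_anchorPositiveK` — AnchorPositiveᴷ ⟹ 2ᶜᴰ with NO U3 letter, by the named jets' hypothesis-free rate — and D1-W2 g2
  `…K2CornerDriftOfNamedJets` (value forms, per-tuple iff, sign hand-back); node N17's keying is dag-n17-w1 g4's `…N17RunWindowShiftCornerDrift`; none restated here.)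

HONEST FRAMING.  Implications between displayed HYPOTHESIS SHAPES and elementary real bookkeeping; NOTHING of Bałaban's analysis is asserted or discharged: N17, the history
moduli, the existence ∕ drift ∕ sign of the corner limits are hypotheses inhabited at no θ here (instance 0∕1); no stub proved; K2⁷ ∕ K3⁷ ∕ NODE O NOT proved (skeleton of
record at filing: v6 5a75a2378c79b303, v7c in its confirm window); counts unmoved (typed 28∕28 · discharged 5∕27); [Balaban1987RG1] Thm 2 + (0.31) p. 259 is UNPROVED IN
PRINT; route R4 closes the CONDITIONAL finite-𝕋⁴ rung `BalabanLadder.UV` only — NOT the continuum limit, NOT ℝ⁴, NOT OS, NOT the Yang–Mills mass gap, NOT Clay.  No `def`, no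
`instance`, no `notation`, no `axiom`.  Sources (context only): [I] = [Balaban1987RG1] CMP **109** (1987): Thm 2 p. 259 (first sentence), (1.3) p. 260, (1.20)–(1.22) p. 264,
(2.12)–(2.14) p. 268; [II] = [Balaban1988RG2Cluster] CMP **116** (1988): Lemma 3 (2.38) p. 20.
-/

noncomputable section

namespace Summit.QuantumFields.YangMills.Theorems.BalabanUVNodesK2CornerDriftOfU3

open Filter Topology
open Literature.MathematicalPhysics.QuantumFieldTheory.Balaban1983to89
open Literature.MathematicalPhysics.QuantumFieldTheory.Balaban1983to89.FlowStep
open Literature.MathematicalPhysics.QuantumFieldTheory.Balaban1983to89.T4Continuum (T4Family)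
open Literature.MathematicalPhysics.QuantumFieldTheory.Balaban1983to89.T4CouplingMatching (ScaleShiftRate HistLipschitz)
open Literature.MathematicalPhysics.QuantumFieldTheory.Balaban1983to89.Beta.Drift (OneLoopDrift)
open Summit.QuantumFields.YangMills.Theorems.BalabanUVNodesK2NamedJetsRemAt (ScaleAnchor)
open Summit.QuantumFields.YangMills.Theorems.BalabanUVNodesK2V6Defs (Window13)
open Summit.QuantumFields.YangMills.Theorems.BalabanUVNodesK2CornerRoad (tendsto_of_scaleShiftRate_scaleAnchor eventually_ge_of_scaleAnchor_drift oneLoopDrift_of_geometric)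
open Summit.QuantumFields.YangMills.Theorems.BalabanUVNodesK2CornerRoadSign (EndpointGivenBR13SepCoPH_of_u3K_someCornerPosK exists_scaleAnchor_of_histLipschitz)

/-- **DRIFT ⟹ SIGN on K3⁷'s letters: U3ᴷ → 2ᶜᴰ-text → SomeCornerPosᴷ** — per tuple the anchoring `b` of 2ᶜᴰ converges (N17 + anchor), the drift pins its limit at the slope `s > 0`
(Cesàro; p599976 `eventually_ge_of_scaleAnchor_drift` at scale `1`), so `b_k ≥ s∕2` eventually. [cite: Balaban1987RG1, (1.3) p.260 and (1.20)-(1.22) p.264] -/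
theorem someCornerPosK_of_u3K_cornerDriftPosK
    (hU3 : ∀ (F : T4Family) (θ : Node00.Stage13HParams F 2) (hP : θ.Provisos₁₃SepCoPH F 2), (θ.ZhUnity F 2 ∧ θ.SlotsNondegenerate₁₃ F 2) → θ.Admissible F 2 →
      B16.EndStatementBPrinted (Node00.datumOfRecord₁₃SepCoPH F 2 θ hP).C → Window13 F θ hP →
      ∃ (c C ρ : ℝ) (Λ : ℕ → ℕ → ℝ), 0 ≤ c ∧ 0 < ρ ∧ ρ < 1 ∧ ScaleShiftRate c ρ θ.γ (Node00.datumOfRecord₁₃SepCoPH F 2 θ hP).βfun ∧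
        HistLipschitz Λ θ.γ (Node00.datumOfRecord₁₃SepCoPH F 2 θ hP).βfun ∧ T4CouplingMatching.FadingMemory C ρ Λ)
    (hCD : ∀ (F : T4Family) (θ : Node00.Stage13HParams F 2) (hP : θ.Provisos₁₃SepCoPH F 2), (θ.ZhUnity F 2 ∧ θ.SlotsNondegenerate₁₃ F 2) → θ.Admissible F 2 →
      B16.EndStatementBPrinted (Node00.datumOfRecord₁₃SepCoPH F 2 θ hP).C → Window13 F θ hP →
      ∃ (b : ℕ → ℝ) (s A : ℝ), ScaleAnchor (Node00.datumOfRecord₁₃SepCoPH F 2 θ hP).βfun b ∧ 0 < s ∧ OneLoopDrift s A b) :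
    ∀ (F : T4Family) (θ : Node00.Stage13HParams F 2) (hP : θ.Provisos₁₃SepCoPH F 2), (θ.ZhUnity F 2 ∧ θ.SlotsNondegenerate₁₃ F 2) → θ.Admissible F 2 →
      B16.EndStatementBPrinted (Node00.datumOfRecord₁₃SepCoPH F 2 θ hP).C → Window13 F θ hP →
      ∃ b : ℕ → ℝ, ScaleAnchor (Node00.datumOfRecord₁₃SepCoPH F 2 θ hP).βfun b ∧ ∃ e : ℝ, 0 < e ∧ ∃ k₀ : ℕ, ∀ k, k₀ ≤ k → e ≤ b k :=
  fun F θ hP hU hθ hB hwin => by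
  obtain ⟨c, -, ρ, Λ, -, -, hρ1, hss, -, -⟩ := hU3 F θ hP hU hθ hB hwin
  obtain ⟨b, s, A, hb, hs, hdrift⟩ := hCD F θ hP hU hθ hB hwin
  have hb1 : ScaleAnchor (Node00.datumOfRecord₁₃SepCoPH F 2 θ hP).βfun (fun k => (1 : ℝ) * b k) := by simpa only [one_mul] using hb
  exact ⟨b, hb, s / 2, half_pos hs, eventually_ge_of_scaleAnchor_drift hθ.toStage12.toStage9.gamma_pos hρ1 hss one_pos hb1 hdrift hs⟩

/-- **★★★ v7c's JOINT STUB 2ᶜᴰ + K3⁷'s LETTERS CONCLUDE THE CRUX DECL BY NAME: U3ᴷ → 2ᶜᴰ-text → `EndpointGivenBR13SepCoPH`** (drift ⟹ sign above, then p609637's ∃-form κ-free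
concluder, i.e. p599976's sign road at scale `1`).  So a LINE 2 := {`stub_u3Triple13K`, v7c's own `stub_cornerDriftPos13`} closes by ONE `exact`; on this road the (190)-chain stub
1ᶜᴿ is not read (N17's every-height remainder replaces the chain's run rows).  CONDITIONAL on two hypothesis shapes; K2⁷ NOT closed; nothing of Bałaban asserted.
[cite: Balaban1987RG1, Thm 2 p.259 (first sentence), (1.3) p.260, (1.20)-(1.22) p.264 and (2.13) p.268] -/
theorem EndpointGivenBR13SepCoPH_of_u3K_cornerDriftPosK
    (hU3 : ∀ (F : T4Family) (θ : Node00.Stage13HParams F 2) (hP : θ.Provisos₁₃SepCoPH F 2), (θ.ZhUnity F 2 ∧ θ.SlotsNondegenerate₁₃ F 2) → θ.Admissible F 2 →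
      B16.EndStatementBPrinted (Node00.datumOfRecord₁₃SepCoPH F 2 θ hP).C → Window13 F θ hP →
      ∃ (c C ρ : ℝ) (Λ : ℕ → ℕ → ℝ), 0 ≤ c ∧ 0 < ρ ∧ ρ < 1 ∧ ScaleShiftRate c ρ θ.γ (Node00.datumOfRecord₁₃SepCoPH F 2 θ hP).βfun ∧
        HistLipschitz Λ θ.γ (Node00.datumOfRecord₁₃SepCoPH F 2 θ hP).βfun ∧ T4CouplingMatching.FadingMemory C ρ Λ)
    (hCD : ∀ (F : T4Family) (θ : Node00.Stage13HParams F 2) (hP : θ.Provisos₁₃SepCoPH F 2), (θ.ZhUnity F 2 ∧ θ.SlotsNondegenerate₁₃ F 2) → θ.Admissible F 2 →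
      B16.EndStatementBPrinted (Node00.datumOfRecord₁₃SepCoPH F 2 θ hP).C → Window13 F θ hP →
      ∃ (b : ℕ → ℝ) (s A : ℝ), ScaleAnchor (Node00.datumOfRecord₁₃SepCoPH F 2 θ hP).βfun b ∧ 0 < s ∧ OneLoopDrift s A b) :
    Summit.QuantumFields.YangMills.Theses.BalabanUVNodes.EndpointGivenBR13SepCoPH :=
  EndpointGivenBR13SepCoPH_of_u3K_someCornerPosK hU3 (someCornerPosK_of_u3K_cornerDriftPosK hU3 hCD)

/-- **★ SIGN ⟹ DRIFT on K3⁷'s letters: U3ᴷ → SomeCornerPosᴷ → 2ᶜᴰ-text** — N17 + anchor make the anchoring sequence converge GEOMETRICALLY to some `binf` (p599976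
`tendsto_of_scaleShiftRate_scaleAnchor`), the eventual floor gives `binf ≥ e > 0`, and geometric convergence IS a two-sided drift at slope `binf` (p599976 `oneLoopDrift_of_geometric`).
[cite: Balaban1987RG1, (1.20)-(1.22) p.264; Balaban1988RG2Cluster, Lemma 3 (2.38) p.20] -/
theorem cornerDriftPosK_of_u3K_someCornerPosK
    (hU3 : ∀ (F : T4Family) (θ : Node00.Stage13HParams F 2) (hP : θ.Provisos₁₃SepCoPH F 2), (θ.ZhUnity F 2 ∧ θ.SlotsNondegenerate₁₃ F 2) → θ.Admissible F 2 →
      B16.EndStatementBPrinted (Node00.datumOfRecord₁₃SepCoPH F 2 θ hP).C → Window13 F θ hP →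
      ∃ (c C ρ : ℝ) (Λ : ℕ → ℕ → ℝ), 0 ≤ c ∧ 0 < ρ ∧ ρ < 1 ∧ ScaleShiftRate c ρ θ.γ (Node00.datumOfRecord₁₃SepCoPH F 2 θ hP).βfun ∧
        HistLipschitz Λ θ.γ (Node00.datumOfRecord₁₃SepCoPH F 2 θ hP).βfun ∧ T4CouplingMatching.FadingMemory C ρ Λ)
    (hs : ∀ (F : T4Family) (θ : Node00.Stage13HParams F 2) (hP : θ.Provisos₁₃SepCoPH F 2), (θ.ZhUnity F 2 ∧ θ.SlotsNondegenerate₁₃ F 2) → θ.Admissible F 2 →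
      B16.EndStatementBPrinted (Node00.datumOfRecord₁₃SepCoPH F 2 θ hP).C → Window13 F θ hP →
      ∃ b : ℕ → ℝ, ScaleAnchor (Node00.datumOfRecord₁₃SepCoPH F 2 θ hP).βfun b ∧ ∃ e : ℝ, 0 < e ∧ ∃ k₀ : ℕ, ∀ k, k₀ ≤ k → e ≤ b k) :
    ∀ (F : T4Family) (θ : Node00.Stage13HParams F 2) (hP : θ.Provisos₁₃SepCoPH F 2), (θ.ZhUnity F 2 ∧ θ.SlotsNondegenerate₁₃ F 2) → θ.Admissible F 2 →
      B16.EndStatementBPrinted (Node00.datumOfRecord₁₃SepCoPH F 2 θ hP).C → Window13 F θ hP →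
      ∃ (b : ℕ → ℝ) (s A : ℝ), ScaleAnchor (Node00.datumOfRecord₁₃SepCoPH F 2 θ hP).βfun b ∧ 0 < s ∧ OneLoopDrift s A b :=
  fun F θ hP hU hθ hB hwin => by
  obtain ⟨c, -, ρ, Λ, hc0, hρ0, hρ1, hss, -, -⟩ := hU3 F θ hP hU hθ hB hwin
  obtain ⟨b, hb, e, he, k₀, hk₀⟩ := hs F θ hP hU hθ hB hwin
  have hγ : 0 < θ.γ := hθ.toStage12.toStage9.gamma_pos
  obtain ⟨binf, hlim, hrate⟩ := tendsto_of_scaleShiftRate_scaleAnchor hγ hρ1 hb hss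
  have hpos : 0 < binf := lt_of_lt_of_le he (ge_of_tendsto hlim (Filter.eventually_atTop.mpr ⟨k₀, hk₀⟩))
  have hC : 0 ≤ c / (1 - ρ) := div_nonneg hc0 (by linarith)
  exact ⟨b, binf, c / (1 - ρ) * (1 - ρ)⁻¹, hb, hpos, oneLoopDrift_of_geometric hρ0.le hρ1 hC hrate⟩

/-- **★★ GIVEN K3⁷'s LETTERS, v7c's 2ᶜᴰ ⟺ THE κ-FREE SIGN BIT** «some sequence anchoring the β of record is eventually ≥ some e > 0» — so on U3ᴷ the registered joint stub carries,
beyond the EXISTENCE of the corner limits (which U3 supplies: p609637 `exists_scaleAnchor_of_histLipschitz`), exactly ONE BIT: the asymptotic-freedom SIGN at the corner; the drift's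
slope VALUE and summability constant are manufactured by N17. [cite: Balaban1987RG1, (1.3) p.260, (1.20)-(1.22) p.264 and (2.13) p.268] -/
theorem cornerDriftPosK_iff_someCornerPosK_of_u3K
    (hU3 : ∀ (F : T4Family) (θ : Node00.Stage13HParams F 2) (hP : θ.Provisos₁₃SepCoPH F 2), (θ.ZhUnity F 2 ∧ θ.SlotsNondegenerate₁₃ F 2) → θ.Admissible F 2 →
      B16.EndStatementBPrinted (Node00.datumOfRecord₁₃SepCoPH F 2 θ hP).C → Window13 F θ hP →
      ∃ (c C ρ : ℝ) (Λ : ℕ → ℕ → ℝ), 0 ≤ c ∧ 0 < ρ ∧ ρ < 1 ∧ ScaleShiftRate c ρ θ.γ (Node00.datumOfRecord₁₃SepCoPH F 2 θ hP).βfun ∧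
        HistLipschitz Λ θ.γ (Node00.datumOfRecord₁₃SepCoPH F 2 θ hP).βfun ∧ T4CouplingMatching.FadingMemory C ρ Λ) :
    (∀ (F : T4Family) (θ : Node00.Stage13HParams F 2) (hP : θ.Provisos₁₃SepCoPH F 2), (θ.ZhUnity F 2 ∧ θ.SlotsNondegenerate₁₃ F 2) → θ.Admissible F 2 →
        B16.EndStatementBPrinted (Node00.datumOfRecord₁₃SepCoPH F 2 θ hP).C → Window13 F θ hP →
        ∃ (b : ℕ → ℝ) (s A : ℝ), ScaleAnchor (Node00.datumOfRecord₁₃SepCoPH F 2 θ hP).βfun b ∧ 0 < s ∧ OneLoopDrift s A b) ↔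
      ∀ (F : T4Family) (θ : Node00.Stage13HParams F 2) (hP : θ.Provisos₁₃SepCoPH F 2), (θ.ZhUnity F 2 ∧ θ.SlotsNondegenerate₁₃ F 2) → θ.Admissible F 2 →
        B16.EndStatementBPrinted (Node00.datumOfRecord₁₃SepCoPH F 2 θ hP).C → Window13 F θ hP →
        ∃ b : ℕ → ℝ, ScaleAnchor (Node00.datumOfRecord₁₃SepCoPH F 2 θ hP).βfun b ∧ ∃ e : ℝ, 0 < e ∧ ∃ k₀ : ℕ, ∀ k, k₀ ≤ k → e ≤ b k :=
  ⟨someCornerPosK_of_u3K_cornerDriftPosK hU3, cornerDriftPosK_of_u3K_someCornerPosK hU3⟩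

/-- **The ∀-form sign text CornerSignᴷ (p609637 LINE 2⁰) feeds v7c's 2ᶜᴰ on K3⁷'s letters** — existence of an anchoring sequence from the moduli
(`exists_scaleAnchor_of_histLipschitz`), its floor from CornerSignᴷ, then sign ⟹ drift. [cite: Balaban1987RG1, (1.3) p.260 and (2.13) p.268] -/
theorem cornerDriftPosK_of_u3K_cornerSignK
    (hU3 : ∀ (F : T4Family) (θ : Node00.Stage13HParams F 2) (hP : θ.Provisos₁₃SepCoPH F 2), (θ.ZhUnity F 2 ∧ θ.SlotsNondegenerate₁₃ F 2) → θ.Admissible F 2 →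
      B16.EndStatementBPrinted (Node00.datumOfRecord₁₃SepCoPH F 2 θ hP).C → Window13 F θ hP →
      ∃ (c C ρ : ℝ) (Λ : ℕ → ℕ → ℝ), 0 ≤ c ∧ 0 < ρ ∧ ρ < 1 ∧ ScaleShiftRate c ρ θ.γ (Node00.datumOfRecord₁₃SepCoPH F 2 θ hP).βfun ∧
        HistLipschitz Λ θ.γ (Node00.datumOfRecord₁₃SepCoPH F 2 θ hP).βfun ∧ T4CouplingMatching.FadingMemory C ρ Λ)
    (hs : ∀ (F : T4Family) (θ : Node00.Stage13HParams F 2) (hP : θ.Provisos₁₃SepCoPH F 2), (θ.ZhUnity F 2 ∧ θ.SlotsNondegenerate₁₃ F 2) → θ.Admissible F 2 →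
      B16.EndStatementBPrinted (Node00.datumOfRecord₁₃SepCoPH F 2 θ hP).C → Window13 F θ hP →
      ∀ b : ℕ → ℝ, ScaleAnchor (Node00.datumOfRecord₁₃SepCoPH F 2 θ hP).βfun b → ∃ e : ℝ, 0 < e ∧ ∃ k₀ : ℕ, ∀ k, k₀ ≤ k → e ≤ b k) :
    ∀ (F : T4Family) (θ : Node00.Stage13HParams F 2) (hP : θ.Provisos₁₃SepCoPH F 2), (θ.ZhUnity F 2 ∧ θ.SlotsNondegenerate₁₃ F 2) → θ.Admissible F 2 →
      B16.EndStatementBPrinted (Node00.datumOfRecord₁₃SepCoPH F 2 θ hP).C → Window13 F θ hP →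
      ∃ (b : ℕ → ℝ) (s A : ℝ), ScaleAnchor (Node00.datumOfRecord₁₃SepCoPH F 2 θ hP).βfun b ∧ 0 < s ∧ OneLoopDrift s A b := by
  refine cornerDriftPosK_of_u3K_someCornerPosK hU3 fun F θ hP hU hθ hB hwin => ?_
  obtain ⟨c, -, ρ, Λ, -, -, -, -, hL, -⟩ := hU3 F θ hP hU hθ hB hwin
  obtain ⟨b, hb⟩ := exists_scaleAnchor_of_histLipschitz hθ.toStage12.toStage9.gamma_pos hL
  exact ⟨b, hb, hs F θ hP hU hθ hB hwin b hb⟩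

end Summit.QuantumFields.YangMills.Theorems.BalabanUVNodesK2CornerDriftOfU3
end
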